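import Summits.BirchSwinnertonDyer.BirchSwinnertonDyer.Theorems.AlignedTransportAtTwoMainConjectureOfRankZeroBSDAtTwoCubicNarrowRankDoor
import Summits.BirchSwinnertonDyer.BirchSwinnertonDyer.Theorems.ByReductionTypeAtTwoTowerClass27735d
import HarnessLib

/-!
# Route `AlignedTransportAtTwo`, crux C2 `MainConjectureOfRankZeroBSDAtTwo` (stmt-22298), line `birth` — THE RANK DOORS WITH CONCRETE LAYER MODELS
# (`ℚ(β)_m ≅ ℚ(β)(θ_m)`, `Ψ_m(θ_m) = 0`, `Ψ_1 = X² − 2`, `Ψ_{m+1} = Ψ_m² − 2`): the per-curve certificate of C2 as an equality of 2-ranks of the class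
# groups of two EXPLICIT number fields; the models rows at `1727a1` / `2045b1` (`Δ < 0`, plain) and THE FIRST `0 < Δ` ROW of the route, `27735d1` (narrow)

HONEST FRAMING (cell `bsd-f1-sign2`, WIDTH-5 attach seat `bsd-line-att-p4` g25; `--supports stmt-BirchSwinnertonDyer-22298 --as helper`).
THEOREMS ONLY (no `def`, no named fact, no `sorry`). BSD is NOT proved; C2 is NOT closed; its verdict «blocked-on
`Rank1Residual.GreenbergMuConjectureIrreducible`» is untouched; every door / row is CONDITIONAL on the displayed PRINT named facts, the registered stub
MuIneqʳ (verbatim) and the displayed per-curve certificate. No new mathematics: cell bsd-2adic w2 GEN 11's model theorems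
(`nonempty_algEquiv_layer_of_iterate_root`: `K_m ≃ₐ[K] L` for every degree-`2^m` extension `L/K` with a root of `Ψ_m`, `[K:ℚ]` odd;
`NarrowFukuda.narrowMu_of_layer_models_of_finrank_eq_three`) wired into this route's rank doors (att-p4 g24 `…CubicRankDoorLayerOne`, g25 `…CubicNarrowRankDoor`).

WHY. The rows of p754150 / p754207 / `…CubicNarrowRankDoor` display the certificate on the ABSTRACT layers `κP.layer m` of a cyclotomic `ℤ₂`-extension of
`ℚ(β)` — a -data seat computes class groups of fields given by POLYNOMIALS. With the models the certificate is LITERALLY what `bnfinit` / `bnfnarrow` return: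

* §1 `classGroupPRank κ m = rank₂ Cl(L)` for any model `L ≅ ℚ(β)_m` (ring isomorphism; Mathlib `ClassGroup.mulEquiv`), and for any degree-`2^m` extension
  `L ⊇ K` of a cubic `K` containing a root of `Ψ_m`.
* §2 **THE PLAIN MODELS DOOR** (`Δ_W < 0`) `mazurMainConjecture_two_of_muIneqRel_of_classGroup_layer_models` — PRINT⁵ + MuIneqʳ + cell hypotheses + `β` + `m ≥ 1`
  + fields `L ⊇ ℚ(β)` of degree `2^m` with a root of `Ψ_m` and `L' ⊇ ℚ(β)` of degree `2^{m+1}` with a root of `Ψ_{m+1}` and **`rank₂ Cl(L') = rank₂ Cl(L)`**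
  ⟹ `MC₂(W)`; **THE NARROW MODELS DOOR** (both signs) `mazurMainConjecture_two_of_muIneqRel_of_narrowClassGroup_layer_models` — the same with
  **`[Cl⁺(L') : Cl⁺(L')²] = [Cl⁺(L) : Cl⁺(L)²]`**, no sign condition. Both `hμan`-free.
* §3 rows with models at the rung `m = 1` (`L = ℚ(β, θ₁)`, `θ₁² = 2`, `[L : ℚ(β)] = 2`; `L' = ℚ(β, θ₂)`, `(θ₂² − 2)² = 2`, `[L' : ℚ(β)] = 4`):
  `1727a1` (`4x³ − 3x² − 304x + 1100`... i.e. `β` a root of `4x³ + b₂x² + 2b₄x + b₆`; data of record rank₂ `2 = 2`, bsd-2adic kit j300990), `2045b1` (DATA ASK of g24), and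
  **`27735d1` — THE FIRST `0 < Δ_W` ROW OF THE ROUTE** (`N = 27735 = 3·5·43`, `Δ_min = 838564493903354660535 > 0`, `≡ 7 (mod 8)`, `a₂ = +1`, `E[2]` irreducible,
  rank `0`, `#Ш_an = 16`; cell bsd-2adic TOWER-class tree object `…TowerClass27735d`): PRINT⁵ + MuIneqʳ + displayed {`r_an = 0`, `BSD₂(27735d1)` — `N > 5000`, not
  Creutz–Miller; bsd-2adic's `bsdp_two_27735d1_of_towerGap` is an alternative source — , ONE narrow rung: `[Cl⁺(L') : (Cl⁺)²] = [Cl⁺(L) : (Cl⁺)²]` for the totally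
  real cubic `ℚ(β)`, `4β³ + 5β² − 15391228β − 10203477656 = 0`} ⟹ `MC₂(27735d1)`. DATA ASK (-data / -imc): narrow 2-ranks of `Cl⁺(ℚ(β)(√2))` (degree 6) and
  `Cl⁺(ℚ(β)(√(2+√2)))` (degree 12) for that cubic.

PARTITION (D-0171): the `0 < Δ` sub-cell of C2's ledger has its FIRST instance row (certificate displayed, not computed: no partition class moves until -data runs
the narrow ranks). Beyond-print theorem: no. BSD is NOT proved.

References: [Fukuda1994] Thm. 1 (2), p. 264; [Washington1997] §13.1 (`ℚ_n = ℚ(ζ_{2^{n+2}})⁺`, `K_n = Kℚ_n`), Lemma 13.3, §13.3 Prop. 13.22–13.23; [Kida1982JFields];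
[Kato2004Asterisque] Thm. 17.4 (1)(2); [GreenbergLNM1716] Thm. 4.1, Conj. 1.11; [CreutzMiller2012] Thm. 1.1; [CremonaAlgorithms1997] Table 1 (`1727a1`, `2045b1`, `27735d1`).
-/

set_option linter.dupNamespace false
set_option autoImplicit false

noncomputable section

open scoped MatrixGroups ModularForm NumberField Classical
open CongruenceSubgroup WeierstrassCurve Polynomial NumberField Module Field
open Literature.NumberTheory.EllipticCurves Literature.NumberTheory.EllipticCurves.ModularForms
open Literature.NumberTheory.EllipticCurves.Greenberg1999 Literature.NumberTheory.EllipticCurves.Module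
open Literature.NumberTheory.EllipticCurves.Rank1Residual Literature.NumberTheory.EllipticCurves.Rank1Residual.Typed
open Literature.NumberTheory.GaloisRepresentations Literature.NumberTheory.IwasawaTheory
open Literature.NumberTheory.NumberFields (narrowClassNumber NarrowClassGroup)
open Summit.BirchSwinnertonDyer.Rank1Residual Summit.BirchSwinnertonDyer.Rank1Residual.F1Sign2
open Summit.BirchSwinnertonDyer.Rank1Residual.X1.MuLambda Summit.BirchSwinnertonDyer.Rank1Residual.X5
open Summit.BirchSwinnertonDyer.Rank1Residual.X5.Instances
open Summit.BirchSwinnertonDyer.BirchSwinnertonDyer.Theorems.Rank1ResidualX1Defs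
open Summit.BirchSwinnertonDyer.BirchSwinnertonDyer.Theses.AlignedTransportAtTwo
open Summit.BirchSwinnertonDyer.BirchSwinnertonDyer.Theorems.AlignedTransportAtTwoCubicRankDoorLayerOne
  (mazurMainConjecture_two_of_muIneqRel_of_classGroupPRank_succ_eq_of_one_le)
open Summit.BirchSwinnertonDyer.BirchSwinnertonDyer.Theorems.AlignedTransportAtTwoCubicNarrowRankDoor
  (mazurMainConjecture_two_of_muIneqRel_of_narrowRung finrank_adjoin_eq_three_of_forall_not_hasRationalTwoTorsionX)
open Summit.BirchSwinnertonDyer.BirchSwinnertonDyer.Theorems.AlignedTransportAtTwoCubicCarrierRoad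
  (mazurMainConjecture_two_of_muIneqRel_of_narrowMu_cubicField)
open Summit.BirchSwinnertonDyer.BirchSwinnertonDyer.Theorems.TowerClass
open Summit.BirchSwinnertonDyer.BirchSwinnertonDyer.Theorems.AlignedTransportAtTwoOffStratumRow2045b
open Summit.BirchSwinnertonDyer.BirchSwinnertonDyer.Theorems.AlignedTransportAtTwoTwistFamilySmallSeeds
open Summit.BirchSwinnertonDyer.BirchSwinnertonDyer.Theorems (AnalyticMuTwo.red_ne_zero_of_isEvenBranchLiftAtTwo_of_forall_not_hasRationalTwoTorsionX)

namespace Summit.BirchSwinnertonDyer.BirchSwinnertonDyer.Theorems.AlignedTransportAtTwoCubicRankDoorModels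

/-! ## §1 `rank₂ Cl` of a layer read on a model -/

/-- `#(G ⧸ G^q) = #(H ⧸ H^q)` along a group isomorphism `G ≃* H`. [folklore] -/
theorem natCard_quot_range_pow_eq_of_mulEquiv {G H : Type*} [CommGroup G] [CommGroup H] (e : G ≃* H) (q : ℕ) :
    Nat.card (G ⧸ (powMonoidHom q : G →* G).range) = Nat.card (H ⧸ (powMonoidHom q : H →* H).range) := by
  change (powMonoidHom q : G →* G).range.index = (powMonoidHom q : H →* H).range.index
  have hmap : ((powMonoidHom q : G →* G).range).map e.toMonoidHom = (powMonoidHom q : H →* H).range := by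
    ext h
    constructor
    · rintro ⟨x, ⟨y, rfl⟩, rfl⟩
      exact ⟨e y, by rw [powMonoidHom_apply, powMonoidHom_apply, MulEquiv.coe_toMonoidHom, map_pow]⟩
    · rintro ⟨y, rfl⟩
      refine ⟨e.symm y ^ q, ⟨e.symm y, rfl⟩, ?_⟩
      rw [powMonoidHom_apply, MulEquiv.coe_toMonoidHom, map_pow, MulEquiv.apply_symm_apply]
  rw [← hmap, Subgroup.index_map_of_bijective e.bijective]

/-- **`rank₂ Cl(K_n)` read on a model**: `classGroupPRank κ n = ord₂ #(Cl(L) ⧸ Cl(L)²)` along any ring isomorphism `K_n ≃+* L`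
(`Cl` is functorial in ring isomorphisms, Mathlib `ClassGroup.mulEquiv`). [cite: Fukuda1994, Thm. 1 (2), p. 264 (`rank(A_n)`)] -/
theorem classGroupPRank_eq_of_ringEquiv {K : Type} [Field K] [NumberField K] (κ : ZpExtension K 2) (n : ℕ)
    {L : Type*} [Field L] [NumberField L] (e : ↥(κ.layer n) ≃+* L) :
    classGroupPRank κ n = padicValNat 2 (Nat.card (ClassGroup (𝓞 L) ⧸ (powMonoidHom 2 : ClassGroup (𝓞 L) →* ClassGroup (𝓞 L)).range)) := by
  rw [classGroupPRank_def]
  exact congrArg _ (natCard_quot_range_pow_eq_of_mulEquiv (ClassGroup.mulEquiv (RingOfIntegers.mapRingEquiv e)) 2)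

/-- **`rank₂ Cl(K_n) = rank₂ Cl(L)` for every degree-`2ⁿ` extension `L ⊇ K` with a root of `Ψ_n`** (`[K:ℚ]` odd, `κ` cyclotomic: `K_n ≃ₐ[K] L` by bsd-2adic's
`nonempty_algEquiv_layer_of_iterate_root`). [cite: Washington1997, §13.1 (`K_n = Kℚ_n`, `[K_n : K] = 2ⁿ`)] [cite: Fukuda1994, Thm. 1 (2), p. 264] -/
theorem classGroupPRank_eq_of_iterate_root {K : Type} [Field K] [NumberField K] (hodd : Odd (Module.finrank ℚ K))
    (κ : ZpExtension K 2) (hκ : κ.IsCyclotomic) (L : Type*) [Field L] [NumberField L] [Algebra K L] {n : ℕ}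
    (hL : Module.finrank K L = 2 ^ n) (θ : L) (hθ : (fun x : L => x ^ 2 - 2)^[n] θ = 0) :
    classGroupPRank κ n = padicValNat 2 (Nat.card (ClassGroup (𝓞 L) ⧸ (powMonoidHom 2 : ClassGroup (𝓞 L) →* ClassGroup (𝓞 L)).range)) := by
  haveI : FiniteDimensional K L := Module.Finite.of_restrictScalars_finite ℚ K L
  obtain ⟨e⟩ := nonempty_algEquiv_layer_of_iterate_root hodd κ hκ L hL θ hθ
  exact classGroupPRank_eq_of_ringEquiv κ n e.toRingEquiv

/-- **The plain rung on models** (cubic `K`): `L ⊇ K` of degree `2^m` with a root of `Ψ_m`, `L' ⊇ K` of degree `2^{m+1}` with a root of `Ψ_{m+1}` and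
`rank₂ Cl(L') = rank₂ Cl(L)` give `classGroupPRank κ (m+1) = classGroupPRank κ m` for EVERY cyclotomic `ℤ₂`-extension `κ` of `K`.
[cite: Washington1997, §13.1] [cite: Fukuda1994, Thm. 1 (2), p. 264] -/
theorem forall_classGroupPRank_succ_eq_of_layer_models {K : Type} [Field K] [NumberField K] (h3 : Module.finrank ℚ K = 3) (m : ℕ)
    (L : Type*) [Field L] [NumberField L] [Algebra K L] (hL : Module.finrank K L = 2 ^ m) (θ : L)
    (hθ : (fun x : L => x ^ 2 - 2)^[m] θ = 0)
    (L' : Type*) [Field L'] [NumberField L'] [Algebra K L'] (hL' : Module.finrank K L' = 2 ^ (m + 1)) (θ' : L')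
    (hθ' : (fun x : L' => x ^ 2 - 2)^[m + 1] θ' = 0)
    (hr : padicValNat 2 (Nat.card (ClassGroup (𝓞 L') ⧸ (powMonoidHom 2 : ClassGroup (𝓞 L') →* ClassGroup (𝓞 L')).range)) =
      padicValNat 2 (Nat.card (ClassGroup (𝓞 L) ⧸ (powMonoidHom 2 : ClassGroup (𝓞 L) →* ClassGroup (𝓞 L)).range))) :
    ∀ κ : ZpExtension K 2, κ.IsCyclotomic → classGroupPRank κ (m + 1) = classGroupPRank κ m := by
  have hodd : Odd (Module.finrank ℚ K) := by rw [h3]; decide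
  intro κ hκ
  rw [classGroupPRank_eq_of_iterate_root hodd κ hκ L' hL' θ' hθ', classGroupPRank_eq_of_iterate_root hodd κ hκ L hL θ hθ, hr]

/-! ## §2 The rank doors on concrete layer models (`hμan`-free) -/

section Doors

variable (W : WeierstrassCurve ℚ) [W.IsElliptic] [W.IsGloballyMinimal]

/-- **THE PLAIN MODELS DOOR (`Δ_W < 0`).** PRINT⁵ {Kato 17.4 (1)(2) at `2`, Greenberg 4.1, period unit, modularity, GZK} + MuIneqʳ + cell hypotheses (good ordinary
at `2`, no rational `2`-torsion abscissa, `Δ_W < 0`, `r_an = 0`, `BSD₂(W)`) + `β` a root of the `2`-division cubic + `m ≥ 1` + number fields `L ⊇ ℚ(β)` of degree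
`2^m` with a root of `Ψ_m` and `L' ⊇ ℚ(β)` of degree `2^{m+1}` with a root of `Ψ_{m+1}` (ANY models of the layers `ℚ(β)_m ⊂ ℚ(β)_{m+1}`) with
**`rank₂ Cl(L') = rank₂ Cl(L)`** ⟹ `MC₂(W)` (g24's layer-`≥ 1` rank door on §1). At `m = 1`: `L = ℚ(β, √2)`, `L' = ℚ(β, √(2+√2))`. CONDITIONAL; nothing closed;
BSD is NOT proved. [cite: Fukuda1994, Thm. 1 (2), p. 264] [cite: Washington1997, §13.1 and Lemma 13.3] [cite: Kato2004Asterisque, Thm. 17.4 (1)(2) (p. 273)]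
[cite: GreenbergLNM1716, Thm. 4.1 (p. 102) and Conj. 1.11 (p. 58)] -/
theorem mazurMainConjecture_two_of_muIneqRel_of_classGroup_layer_models
    (h17 : ∀ [NeZero (W.conductorNorm ℤ)] (f : CuspForm (Gamma0 (W.conductorNorm ℤ)) 2),
      kato_divisibility_allPrimes W 2 (f := f))
    (hGr : Greenberg1999.thm41_charValue_rankZero_anyPrime)
    (hper : realPeriodRat_eq_unit_mul_plusPeriod_two) (hmod : nonempty_modularParametrizationData)
    (hGZK : rank_eq_analyticRank_of_analyticRank_le_one)
    (hI : ∀ (W : WeierstrassCurve ℚ) [W.IsElliptic] [W.IsGloballyMinimal], IsOrdinaryAt W 2 →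
      (∀ x : ℚ, ¬ HasRationalTwoTorsionX W x) →
      ∀ (κ : ZpExtension ℚ 2) (γ : Field.absoluteGaloisGroup ℚ), κ.IsCyclotomic →
      κ.IsTopGenerator γ → IsCyclotomicVariable 2 γ →
      ∀ ⦃N : ℕ⦄ [NeZero N] (f : CuspForm (Gamma0 N) 2), IsNewformOf W f →
      ∀ Gp : IwasawaAlgebra 2, iwasawaToPowerSeries 2 Gp = padicLFunction f (unitRoot W 2 : ℚ_[2]) →
      ∀ (D : W.SelmerDualData κ γ) (Yr : W.FineSelmerDualDataRelaxedInf κ γ),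
        lengthAt (IwasawaAlgebra 2) D.X ⟨IwasawaAlgebra.augIdealP 2, IwasawaAlgebra.isPrime_augIdealP_holds 2⟩ ≤
          lengthAt (IwasawaAlgebra 2) (IwasawaAlgebra 2 ⧸ Ideal.span {Gp})
              ⟨IwasawaAlgebra.augIdealP 2, IwasawaAlgebra.isPrime_augIdealP_holds 2⟩ +
            lengthAt (IwasawaAlgebra 2) Yr.X ⟨IwasawaAlgebra.augIdealP 2, IwasawaAlgebra.isPrime_augIdealP_holds 2⟩)
    (hord : IsOrdinaryAt W 2) (ht : ∀ x : ℚ, ¬ HasRationalTwoTorsionX W x) (hΔ : W.Δ < 0) (hr : W.analyticRank = 0) (hbsd : BSDp W 2)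
    {β : AlgebraicClosure ℚ} (hβ : aeval β W.twoTorsionPolynomial.toPoly = 0) {m : ℕ} (hm : 1 ≤ m)
    (L : Type) [Field L] [NumberField L] [Algebra ↥(IntermediateField.adjoin ℚ ({β} : Set (AlgebraicClosure ℚ))) L]
    (hL : Module.finrank ↥(IntermediateField.adjoin ℚ ({β} : Set (AlgebraicClosure ℚ))) L = 2 ^ m) (θ : L)
    (hθ : (fun x : L => x ^ 2 - 2)^[m] θ = 0)
    (L' : Type) [Field L'] [NumberField L'] [Algebra ↥(IntermediateField.adjoin ℚ ({β} : Set (AlgebraicClosure ℚ))) L']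
    (hL' : Module.finrank ↥(IntermediateField.adjoin ℚ ({β} : Set (AlgebraicClosure ℚ))) L' = 2 ^ (m + 1)) (θ' : L')
    (hθ' : (fun x : L' => x ^ 2 - 2)^[m + 1] θ' = 0)
    (hrank : padicValNat 2 (Nat.card (ClassGroup (𝓞 L') ⧸ (powMonoidHom 2 : ClassGroup (𝓞 L') →* ClassGroup (𝓞 L')).range)) =
      padicValNat 2 (Nat.card (ClassGroup (𝓞 L) ⧸ (powMonoidHom 2 : ClassGroup (𝓞 L) →* ClassGroup (𝓞 L)).range))) :
    MazurMainConjecture W 2 := by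
  haveI : FiniteDimensional ℚ ↥(IntermediateField.adjoin ℚ ({β} : Set (AlgebraicClosure ℚ))) :=
    IntermediateField.adjoin.finiteDimensional ((AlgebraicClosure.isAlgebraic ℚ).isAlgebraic β).isIntegral
  haveI : NumberField ↥(IntermediateField.adjoin ℚ ({β} : Set (AlgebraicClosure ℚ))) := NumberField.mk
  have h3 := finrank_adjoin_eq_three_of_forall_not_hasRationalTwoTorsionX W ht hβ
  exact mazurMainConjecture_two_of_muIneqRel_of_classGroupPRank_succ_eq_of_one_le W h17 hGr hper hmod hGZK hI hord ht hΔ hr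
    (AnalyticMuTwo.red_ne_zero_of_isEvenBranchLiftAtTwo_of_forall_not_hasRationalTwoTorsionX W hord ht) hbsd hβ
    fun κP hκP => ⟨m, hm, forall_classGroupPRank_succ_eq_of_layer_models h3 m L hL θ hθ L' hL' θ' hθ' hrank κP hκP⟩

/-- **THE NARROW MODELS DOOR (both signs of `Δ_W`).** PRINT⁵ + MuIneqʳ + cell hypotheses (good ordinary at `2`, no rational `2`-torsion abscissa, `r_an = 0`,
`BSD₂(W)`) + `β` + `m ≥ 1` + models `L ⊇ ℚ(β)` (degree `2^m`, root of `Ψ_m`), `L' ⊇ ℚ(β)` (degree `2^{m+1}`, root of `Ψ_{m+1}`) with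
**`[Cl⁺(L') : Cl⁺(L')²] = [Cl⁺(L) : Cl⁺(L)²]`** ⟹ `MC₂(W)` — NO sign condition (bsd-2adic's `NarrowFukuda.narrowMu_of_layer_models_of_finrank_eq_three`, then
att-p5 g24's `…_of_narrowMu_cubicField`). CONDITIONAL; nothing closed; BSD is NOT proved. [cite: Fukuda1994, Thm. 1 (2), p. 264] [cite: Washington1997, §13.1]
[cite: Kida1982JFields, main theorem (μ-part; shape only)] [cite: Kato2004Asterisque, Thm. 17.4 (1)(2) (p. 273)] [cite: GreenbergLNM1716, Thm. 4.1 (p. 102)] -/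
theorem mazurMainConjecture_two_of_muIneqRel_of_narrowClassGroup_layer_models
    (h17 : ∀ [NeZero (W.conductorNorm ℤ)] (f : CuspForm (Gamma0 (W.conductorNorm ℤ)) 2),
      kato_divisibility_allPrimes W 2 (f := f))
    (hGr : Greenberg1999.thm41_charValue_rankZero_anyPrime)
    (hper : realPeriodRat_eq_unit_mul_plusPeriod_two) (hmod : nonempty_modularParametrizationData)
    (hGZK : rank_eq_analyticRank_of_analyticRank_le_one)
    (hI : ∀ (W : WeierstrassCurve ℚ) [W.IsElliptic] [W.IsGloballyMinimal], IsOrdinaryAt W 2 →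
      (∀ x : ℚ, ¬ HasRationalTwoTorsionX W x) →
      ∀ (κ : ZpExtension ℚ 2) (γ : Field.absoluteGaloisGroup ℚ), κ.IsCyclotomic →
      κ.IsTopGenerator γ → IsCyclotomicVariable 2 γ →
      ∀ ⦃N : ℕ⦄ [NeZero N] (f : CuspForm (Gamma0 N) 2), IsNewformOf W f →
      ∀ Gp : IwasawaAlgebra 2, iwasawaToPowerSeries 2 Gp = padicLFunction f (unitRoot W 2 : ℚ_[2]) →
      ∀ (D : W.SelmerDualData κ γ) (Yr : W.FineSelmerDualDataRelaxedInf κ γ),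
        lengthAt (IwasawaAlgebra 2) D.X ⟨IwasawaAlgebra.augIdealP 2, IwasawaAlgebra.isPrime_augIdealP_holds 2⟩ ≤
          lengthAt (IwasawaAlgebra 2) (IwasawaAlgebra 2 ⧸ Ideal.span {Gp})
              ⟨IwasawaAlgebra.augIdealP 2, IwasawaAlgebra.isPrime_augIdealP_holds 2⟩ +
            lengthAt (IwasawaAlgebra 2) Yr.X ⟨IwasawaAlgebra.augIdealP 2, IwasawaAlgebra.isPrime_augIdealP_holds 2⟩)
    (hord : IsOrdinaryAt W 2) (ht : ∀ x : ℚ, ¬ HasRationalTwoTorsionX W x) (hr : W.analyticRank = 0) (hbsd : BSDp W 2)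
    {β : AlgebraicClosure ℚ} (hβ : aeval β W.twoTorsionPolynomial.toPoly = 0) {m : ℕ} (hm : 1 ≤ m)
    (L : Type) [Field L] [NumberField L] [Algebra ↥(IntermediateField.adjoin ℚ ({β} : Set (AlgebraicClosure ℚ))) L]
    (hL : Module.finrank ↥(IntermediateField.adjoin ℚ ({β} : Set (AlgebraicClosure ℚ))) L = 2 ^ m) (θ : L)
    (hθ : (fun x : L => x ^ 2 - 2)^[m] θ = 0)
    (L' : Type) [Field L'] [NumberField L'] [Algebra ↥(IntermediateField.adjoin ℚ ({β} : Set (AlgebraicClosure ℚ))) L']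
    (hL' : Module.finrank ↥(IntermediateField.adjoin ℚ ({β} : Set (AlgebraicClosure ℚ))) L' = 2 ^ (m + 1)) (θ' : L')
    (hθ' : (fun x : L' => x ^ 2 - 2)^[m + 1] θ' = 0)
    (hnarrow : (powMonoidHom (α := NarrowClassGroup L') 2).range.index = (powMonoidHom (α := NarrowClassGroup L) 2).range.index) :
    MazurMainConjecture W 2 := by
  haveI : FiniteDimensional ℚ ↥(IntermediateField.adjoin ℚ ({β} : Set (AlgebraicClosure ℚ))) :=
    IntermediateField.adjoin.finiteDimensional ((AlgebraicClosure.isAlgebraic ℚ).isAlgebraic β).isIntegral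
  haveI : NumberField ↥(IntermediateField.adjoin ℚ ({β} : Set (AlgebraicClosure ℚ))) := NumberField.mk
  have h3 := finrank_adjoin_eq_three_of_forall_not_hasRationalTwoTorsionX W ht hβ
  obtain ⟨hμ, D, hδ⟩ := NarrowFukuda.narrowMu_of_layer_models_of_finrank_eq_three _ h3 m hm L hL θ hθ L' hL' θ' hθ' hnarrow
  exact mazurMainConjecture_two_of_muIneqRel_of_narrowMu_cubicField W h17 hGr hper hmod hGZK hI hord ht hr
    (AnalyticMuTwo.red_ne_zero_of_isEvenBranchLiftAtTwo_of_forall_not_hasRationalTwoTorsionX W hord ht) hbsd hβ hμ D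
    (fun κP hκP n _ => hδ κP hκP n)

end Doors

/-! ## §3 Rows on the layer-`(1,2)` models: `1727a1`, `2045b1` (`Δ < 0`, plain) and `27735d1` — the first `0 < Δ` row (narrow) -/

/-- **ROW `1727a1` ON MODELS**: PRINT⁵ + Creutz–Miller + MuIneqʳ + displayed {`r_an(1727a1) = 0`; number fields `L = ℚ(β, θ₁)`, `θ₁² = 2`, `[L : ℚ(β)] = 2` and
`L' = ℚ(β, θ₂)`, `(θ₂² − 2)² = 2`, `[L' : ℚ(β)] = 4`, with `rank₂ Cl(L') = rank₂ Cl(L)`} ⟹ `MC₂(1727a1)` — `β` any root of `4x³ + b₂x² + 2b₄x + b₆` of Cremona's model.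
Data of record: `2 = 2` (bsd-2adic kit j300990). CONDITIONAL; BSD is NOT proved. [cite: Fukuda1994, Thm. 1 (2), p. 264] [cite: CreutzMiller2012, Thm. 1.1]
[cite: Kato2004Asterisque, Thm. 17.4 (1)(2) (p. 273)] -/
theorem mazurMainConjecture_two_1727a1_of_classGroup_layerOneTwo_models
    (h17 : ∀ [NeZero (c1727a1.conductorNorm ℤ)] (f : CuspForm (Gamma0 (c1727a1.conductorNorm ℤ)) 2),
      kato_divisibility_allPrimes c1727a1 2 (f := f))
    (hGr : Greenberg1999.thm41_charValue_rankZero_anyPrime)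
    (hper : realPeriodRat_eq_unit_mul_plusPeriod_two) (hmod : nonempty_modularParametrizationData)
    (hGZK : rank_eq_analyticRank_of_analyticRank_le_one) (hCM : bsdTriple_of_rank_le_one_of_conductor_lt)
    (hI : ∀ (W : WeierstrassCurve ℚ) [W.IsElliptic] [W.IsGloballyMinimal], IsOrdinaryAt W 2 →
      (∀ x : ℚ, ¬ HasRationalTwoTorsionX W x) →
      ∀ (κ : ZpExtension ℚ 2) (γ : Field.absoluteGaloisGroup ℚ), κ.IsCyclotomic →
      κ.IsTopGenerator γ → IsCyclotomicVariable 2 γ →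
      ∀ ⦃N : ℕ⦄ [NeZero N] (f : CuspForm (Gamma0 N) 2), IsNewformOf W f →
      ∀ Gp : IwasawaAlgebra 2, iwasawaToPowerSeries 2 Gp = padicLFunction f (unitRoot W 2 : ℚ_[2]) →
      ∀ (D : W.SelmerDualData κ γ) (Yr : W.FineSelmerDualDataRelaxedInf κ γ),
        lengthAt (IwasawaAlgebra 2) D.X ⟨IwasawaAlgebra.augIdealP 2, IwasawaAlgebra.isPrime_augIdealP_holds 2⟩ ≤
          lengthAt (IwasawaAlgebra 2) (IwasawaAlgebra 2 ⧸ Ideal.span {Gp})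
              ⟨IwasawaAlgebra.augIdealP 2, IwasawaAlgebra.isPrime_augIdealP_holds 2⟩ +
            lengthAt (IwasawaAlgebra 2) Yr.X ⟨IwasawaAlgebra.augIdealP 2, IwasawaAlgebra.isPrime_augIdealP_holds 2⟩)
    (hr0 : c1727a1.analyticRank = 0)
    {β : AlgebraicClosure ℚ} (hβ : aeval β c1727a1.twoTorsionPolynomial.toPoly = 0)
    (L : Type) [Field L] [NumberField L] [Algebra ↥(IntermediateField.adjoin ℚ ({β} : Set (AlgebraicClosure ℚ))) L]
    (hL : Module.finrank ↥(IntermediateField.adjoin ℚ ({β} : Set (AlgebraicClosure ℚ))) L = 2) (θ₁ : L) (hθ₁ : θ₁ ^ 2 = 2)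
    (L' : Type) [Field L'] [NumberField L'] [Algebra ↥(IntermediateField.adjoin ℚ ({β} : Set (AlgebraicClosure ℚ))) L']
    (hL' : Module.finrank ↥(IntermediateField.adjoin ℚ ({β} : Set (AlgebraicClosure ℚ))) L' = 4) (θ₂ : L') (hθ₂ : (θ₂ ^ 2 - 2) ^ 2 = 2)
    (hrank : padicValNat 2 (Nat.card (ClassGroup (𝓞 L') ⧸ (powMonoidHom 2 : ClassGroup (𝓞 L') →* ClassGroup (𝓞 L')).range)) =
      padicValNat 2 (Nat.card (ClassGroup (𝓞 L) ⧸ (powMonoidHom 2 : ClassGroup (𝓞 L) →* ClassGroup (𝓞 L)).range))) :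
    MazurMainConjecture c1727a1 2 :=
  mazurMainConjecture_two_of_muIneqRel_of_classGroup_layer_models c1727a1 h17 hGr hper hmod hGZK hI goodOrd_two_1727a1
    not_hasRationalTwoTorsionX_1727a1 Δ_1727a1_neg' hr0 (bsdp_two_1727a1_of_creutzMiller hCM hGZK hr0) hβ le_rfl
    L (by rw [hL]; norm_num) θ₁ (by simp only [Function.iterate_one]; rw [hθ₁]; ring)
    L' (by rw [hL']; norm_num) θ₂ (by rw [iterate_sq_sub_two_two, hθ₂]; ring) hrank

/-- **ROW `2045b1` ON MODELS** (off the stratum, `Δ_min ≡ 3 (mod 8)`): PRINT⁵ + Creutz–Miller + MuIneqʳ + displayed {`r_an(2045b1) = 0`; `L = ℚ(β, θ₁)`, `θ₁² = 2`,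
`[L : ℚ(β)] = 2`; `L' = ℚ(β, θ₂)`, `(θ₂² − 2)² = 2`, `[L' : ℚ(β)] = 4`; `rank₂ Cl(L') = rank₂ Cl(L)`} ⟹ `MC₂(2045b1)` — g24's DATA ASK in the form -data computes
(`β` a root of `4x³ + b₂x² + 2b₄x + b₆` of `[1,−1,0,−5470,−862675]`). CONDITIONAL; BSD is NOT proved. [cite: Fukuda1994, Thm. 1 (2), p. 264] [cite: CreutzMiller2012, Thm. 1.1]
[cite: Kato2004Asterisque, Thm. 17.4 (1)(2) (p. 273)] -/
theorem mazurMainConjecture_two_2045b1_of_classGroup_layerOneTwo_models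
    (h17 : ∀ [NeZero (c2045b1.conductorNorm ℤ)] (f : CuspForm (Gamma0 (c2045b1.conductorNorm ℤ)) 2),
      kato_divisibility_allPrimes c2045b1 2 (f := f))
    (hGr : Greenberg1999.thm41_charValue_rankZero_anyPrime)
    (hper : realPeriodRat_eq_unit_mul_plusPeriod_two) (hmod : nonempty_modularParametrizationData)
    (hGZK : rank_eq_analyticRank_of_analyticRank_le_one) (hCM : bsdTriple_of_rank_le_one_of_conductor_lt)
    (hI : ∀ (W : WeierstrassCurve ℚ) [W.IsElliptic] [W.IsGloballyMinimal], IsOrdinaryAt W 2 →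
      (∀ x : ℚ, ¬ HasRationalTwoTorsionX W x) →
      ∀ (κ : ZpExtension ℚ 2) (γ : Field.absoluteGaloisGroup ℚ), κ.IsCyclotomic →
      κ.IsTopGenerator γ → IsCyclotomicVariable 2 γ →
      ∀ ⦃N : ℕ⦄ [NeZero N] (f : CuspForm (Gamma0 N) 2), IsNewformOf W f →
      ∀ Gp : IwasawaAlgebra 2, iwasawaToPowerSeries 2 Gp = padicLFunction f (unitRoot W 2 : ℚ_[2]) →
      ∀ (D : W.SelmerDualData κ γ) (Yr : W.FineSelmerDualDataRelaxedInf κ γ),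
        lengthAt (IwasawaAlgebra 2) D.X ⟨IwasawaAlgebra.augIdealP 2, IwasawaAlgebra.isPrime_augIdealP_holds 2⟩ ≤
          lengthAt (IwasawaAlgebra 2) (IwasawaAlgebra 2 ⧸ Ideal.span {Gp})
              ⟨IwasawaAlgebra.augIdealP 2, IwasawaAlgebra.isPrime_augIdealP_holds 2⟩ +
            lengthAt (IwasawaAlgebra 2) Yr.X ⟨IwasawaAlgebra.augIdealP 2, IwasawaAlgebra.isPrime_augIdealP_holds 2⟩)
    (hr0 : c2045b1.analyticRank = 0)
    {β : AlgebraicClosure ℚ} (hβ : aeval β c2045b1.twoTorsionPolynomial.toPoly = 0)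
    (L : Type) [Field L] [NumberField L] [Algebra ↥(IntermediateField.adjoin ℚ ({β} : Set (AlgebraicClosure ℚ))) L]
    (hL : Module.finrank ↥(IntermediateField.adjoin ℚ ({β} : Set (AlgebraicClosure ℚ))) L = 2) (θ₁ : L) (hθ₁ : θ₁ ^ 2 = 2)
    (L' : Type) [Field L'] [NumberField L'] [Algebra ↥(IntermediateField.adjoin ℚ ({β} : Set (AlgebraicClosure ℚ))) L']
    (hL' : Module.finrank ↥(IntermediateField.adjoin ℚ ({β} : Set (AlgebraicClosure ℚ))) L' = 4) (θ₂ : L') (hθ₂ : (θ₂ ^ 2 - 2) ^ 2 = 2)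
    (hrank : padicValNat 2 (Nat.card (ClassGroup (𝓞 L') ⧸ (powMonoidHom 2 : ClassGroup (𝓞 L') →* ClassGroup (𝓞 L')).range)) =
      padicValNat 2 (Nat.card (ClassGroup (𝓞 L) ⧸ (powMonoidHom 2 : ClassGroup (𝓞 L) →* ClassGroup (𝓞 L)).range))) :
    MazurMainConjecture c2045b1 2 :=
  mazurMainConjecture_two_of_muIneqRel_of_classGroup_layer_models c2045b1 h17 hGr hper hmod hGZK hI goodOrd_two_2045b1
    not_hasRationalTwoTorsionX_2045b1 Δ_2045b1_neg hr0 (bsdp_two_2045b1_of_creutzMiller hCM hGZK hr0) hβ le_rfl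
    L (by rw [hL]; norm_num) θ₁ (by simp only [Function.iterate_one]; rw [hθ₁]; ring)
    L' (by rw [hL']; norm_num) θ₂ (by rw [iterate_sq_sub_two_two, hθ₂]; ring) hrank

/-- No rational `2`-torsion abscissa on `27735d1` (`E[2]` irreducible: bsd-2adic's `irr_two_27735d1`, no root of the monic `2`-division cubic mod `7`).
[cite: SilvermanAEC2009, III.2.3 (b)] -/
theorem not_hasRationalTwoTorsionX_27735d1 : ∀ x : ℚ, ¬ HasRationalTwoTorsionX c27735d1 x := by
  intro x hx
  exact (O1.irr_two_iff_not_exists_addOrderOf_eq_two c27735d1).mp irr_two_27735d1 (exists_point_addOrderOf_eq_two hx)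

/-- `0 < Δ(27735d1)` (`Δ = Δ_min = 838564493903354660535 = 3¹⁵·5·43⁸`): the totally real side of the cell. [cite: CremonaAlgorithms1997, Table 1] -/
theorem Δ_27735d1_pos : 0 < c27735d1.Δ := by
  rw [show c27735d1.Δ = ((M27735d1.Δ : ℤ) : ℚ) from (WeierstrassCurve.map_Δ M27735d1 (algebraMap ℤ ℚ)), M27735d1_Δ]
  norm_num

/-- `Δ_min(27735d1) ≡ 7 (mod 8)`: in the totally real cubic `ℚ(β)` the prime `2` factors as `𝔭₁𝔭₂²` (att-p5 g27's Dedekind table, `Δ_min ≡ 3 (mod 4)`).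
[cite: CremonaAlgorithms1997, Table 1] -/
theorem minimalDiscriminantInt_emod_eight_27735d1 : c27735d1.minimalDiscriminantInt % 8 = 7 := by
  rw [minimalDiscriminantInt_27735d1]; decide

/-- **ROW `27735d1` — THE FIRST `0 < Δ_W` ROW OF THE ROUTE, narrow models at the rung `m = 1`.** PRINT⁵ {Kato 17.4 (1)(2) at `2` for `27735d1`, Greenberg 4.1,
period unit, modularity, GZK} + MuIneqʳ (verbatim) + displayed {`r_an(27735d1) = 0`, `BSD₂(27735d1)` (`N = 27735 > 5000`: not Creutz–Miller; the cell bsd-2adic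
road `TowerClass.bsdp_two_27735d1_of_towerGap` is an alternative, certificate-priced source); number fields `L = ℚ(β, θ₁)`, `θ₁² = 2`, `[L : ℚ(β)] = 2` and
`L' = ℚ(β, θ₂)`, `(θ₂² − 2)² = 2`, `[L' : ℚ(β)] = 4`, with **`[Cl⁺(L') : Cl⁺(L')²] = [Cl⁺(L) : Cl⁺(L)²]`**} ⟹ `MC₂(27735d1)`; `β` any root of
`4x³ + 5x² − 15391228x − 10203477656` (the `2`-division cubic of `[1,1,0,−3847807,−2550869414]`; `ℚ(β)` totally real, `2 = 𝔭₁𝔭₂²` there). Good ordinary at `2` and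
`E[2]` irreducible are KERNEL (bsd-2adic `…TowerClass27735d`). DATA ASK (-data / -imc): the two narrow 2-ranks. CONDITIONAL; BSD is NOT proved.
[cite: Fukuda1994, Thm. 1 (2), p. 264] [cite: Kida1982JFields, main theorem (μ-part; shape only)] [cite: Kato2004Asterisque, Thm. 17.4 (1)(2) (p. 273)]
[cite: GreenbergLNM1716, Thm. 4.1 (p. 102) and Conj. 1.11 (p. 58)] [cite: CremonaAlgorithms1997, Table 1] -/
theorem mazurMainConjecture_two_27735d1_of_narrowClassGroup_layerOneTwo_models
    (h17 : ∀ [NeZero (c27735d1.conductorNorm ℤ)] (f : CuspForm (Gamma0 (c27735d1.conductorNorm ℤ)) 2),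
      kato_divisibility_allPrimes c27735d1 2 (f := f))
    (hGr : Greenberg1999.thm41_charValue_rankZero_anyPrime)
    (hper : realPeriodRat_eq_unit_mul_plusPeriod_two) (hmod : nonempty_modularParametrizationData)
    (hGZK : rank_eq_analyticRank_of_analyticRank_le_one)
    (hI : ∀ (W : WeierstrassCurve ℚ) [W.IsElliptic] [W.IsGloballyMinimal], IsOrdinaryAt W 2 →
      (∀ x : ℚ, ¬ HasRationalTwoTorsionX W x) →
      ∀ (κ : ZpExtension ℚ 2) (γ : Field.absoluteGaloisGroup ℚ), κ.IsCyclotomic →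
      κ.IsTopGenerator γ → IsCyclotomicVariable 2 γ →
      ∀ ⦃N : ℕ⦄ [NeZero N] (f : CuspForm (Gamma0 N) 2), IsNewformOf W f →
      ∀ Gp : IwasawaAlgebra 2, iwasawaToPowerSeries 2 Gp = padicLFunction f (unitRoot W 2 : ℚ_[2]) →
      ∀ (D : W.SelmerDualData κ γ) (Yr : W.FineSelmerDualDataRelaxedInf κ γ),
        lengthAt (IwasawaAlgebra 2) D.X ⟨IwasawaAlgebra.augIdealP 2, IwasawaAlgebra.isPrime_augIdealP_holds 2⟩ ≤
          lengthAt (IwasawaAlgebra 2) (IwasawaAlgebra 2 ⧸ Ideal.span {Gp})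
              ⟨IwasawaAlgebra.augIdealP 2, IwasawaAlgebra.isPrime_augIdealP_holds 2⟩ +
            lengthAt (IwasawaAlgebra 2) Yr.X ⟨IwasawaAlgebra.augIdealP 2, IwasawaAlgebra.isPrime_augIdealP_holds 2⟩)
    (hr0 : c27735d1.analyticRank = 0) (hbsd : BSDp c27735d1 2)
    {β : AlgebraicClosure ℚ} (hβ : aeval β c27735d1.twoTorsionPolynomial.toPoly = 0)
    (L : Type) [Field L] [NumberField L] [Algebra ↥(IntermediateField.adjoin ℚ ({β} : Set (AlgebraicClosure ℚ))) L]
    (hL : Module.finrank ↥(IntermediateField.adjoin ℚ ({β} : Set (AlgebraicClosure ℚ))) L = 2) (θ₁ : L) (hθ₁ : θ₁ ^ 2 = 2)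
    (L' : Type) [Field L'] [NumberField L'] [Algebra ↥(IntermediateField.adjoin ℚ ({β} : Set (AlgebraicClosure ℚ))) L']
    (hL' : Module.finrank ↥(IntermediateField.adjoin ℚ ({β} : Set (AlgebraicClosure ℚ))) L' = 4) (θ₂ : L') (hθ₂ : (θ₂ ^ 2 - 2) ^ 2 = 2)
    (hnarrow : (powMonoidHom (α := NarrowClassGroup L') 2).range.index = (powMonoidHom (α := NarrowClassGroup L) 2).range.index) :
    MazurMainConjecture c27735d1 2 :=
  mazurMainConjecture_two_of_muIneqRel_of_narrowClassGroup_layer_models c27735d1 h17 hGr hper hmod hGZK hI goodOrd_two_27735d1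
    not_hasRationalTwoTorsionX_27735d1 hr0 hbsd hβ le_rfl
    L (by rw [hL]; norm_num) θ₁ (by simp only [Function.iterate_one]; rw [hθ₁]; ring)
    L' (by rw [hL']; norm_num) θ₂ (by rw [iterate_sq_sub_two_two, hθ₂]; ring) hnarrow

end Summit.BirchSwinnertonDyer.BirchSwinnertonDyer.Theorems.AlignedTransportAtTwoCubicRankDoorModels

end
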